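import Mathlib
import Summits.ValiantsHypothesis.ValiantsHypothesis.Theorems.RigidityForcesSymmetryRankRigidMinimalReprLaplaceFiveSeparatedCaptureTwoK2Hub

/-!
# ValiantsHypothesis / RigidityForcesSymmetry — crux `LaplaceOptimalFive` (stmt-ValiantsHypothesis-24813), separated capture:
# **THE CAPTURE INEQUALITY HOLDS FOR OBLIGATIONS CAPTURED BY SYMMETRIC PIECES** (the `Ω = 0` sector of `CaptureIneqSym`)

The 3-slot capture inequality (`CaptureIneq` ✓ `…SeparatedCaptureDefs`, its symmetric restriction `CaptureIneqSym` ✓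
`…SeparatedCaptureSym`, both OPEN) asks: if every obligation `P₅ ⌞ μ` (`μ` in a space `W` of symmetric zero-diagonal leaf matrices) lies
in `L3 U₀₁ U₀₂ U₁₂ = U₀₁ ⊗ V₂ + U₀₂ ⊗ V₁ + U₁₂ ⊗ V₀`, is `dim W ≤ dim U₀₁ + dim U₀₂ + dim U₁₂`?  ✓ `capture_one_direction` (Lemma W, the
HUB contraction `T ↦ Σ_r T(p,q,r)` is injective on obligations and maps `U₀₁ ⊗ V₂` into `U₀₁`) settles `U₀₂ = U₁₂ = 0`.

THIS FILE: the same hub argument settles every configuration in which the obligations are captured by pieces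
`A ∈ U₀₁ ⊗ V₂`, `B ∈ U₀₂ ⊗ V₁`, `C ∈ U₁₂ ⊗ V₀` with `B` symmetric in the slots `1,2` and `C` invariant under the cyclic shift of the slots
(e.g. all three pieces FULLY SYMMETRIC 3-tensors): then `B` also lies in `U₀₂ ⊗ V₂` and `C` in `U₁₂ ⊗ V₂` (`swap_mem_L3`, `cycle_mem_L3`), the
hub contraction maps `W` injectively into `U₀₁ + U₀₂ + U₁₂`, and `dim W ≤ dim(U₀₁ ⊔ U₀₂ ⊔ U₁₂) ≤ Σ dim U_ab` (`capture_of_symmetric_pieces`,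
`capture_of_symmetric_pieces'`).  In the polynomial currency of memo `pub/val-lit/lmr/NOTE-p4g17-24813-K32-symmetric-capture.md` §2c/§3a this
is the case `Ω = 0` of `CaptureIneqSym` (all three quadratic vector fields are gradients, the captured cubic lies in the sum of the three
PROLONGATIONS `∂⁻¹U_i`, and `∂_𝟙` is injective on square-free cubics); the general case (common closed 2-form `Ω ≠ 0`) is OPEN.

Honest framing.  A special case of an OPEN inequality; closes nothing; `LaplaceOptimalFive` (OPEN · CONTESTED 72/120), S2′, K1 on `K₃ ⊔ K₂`,
`RankRigidMinimalRepr`, `VP ≠ VNP` are NOT proved.  No definitions, no `sorry`; Mathlib + tree only.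
-/

set_option linter.dupNamespace false
set_option autoImplicit false

namespace Summit.ValiantsHypothesis.ValiantsHypothesis.Theorems.RigidityForcesSymmetryRankRigidMinimalRepr

namespace LaplaceFiveSeparatedCapture

open Finset LaplaceFiveSectorSplit

/-- A piece of direction `02 | 1` becomes a piece of direction `01 | 2` after swapping the slots `1, 2`. [folklore] -/
theorem swap_mem_L3 (U02 : Submodule ℂ (Fin 5 → Fin 5 → ℂ)) (B : Fin 5 → Fin 5 → Fin 5 → ℂ)
    (hB : B ∈ L3 ⊥ U02 ⊥) : (fun p q r => B p r q) ∈ L3 U02 ⊥ ⊥ := by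
  unfold L3 at hB ⊢
  refine Submodule.span_induction ?_ ?_ ?_ ?_ hB
  · rintro T hT
    simp only [Set.mem_union, Set.mem_setOf_eq] at hT
    rcases hT with (⟨u, hu, y, rfl⟩ | ⟨u, hu, y, rfl⟩) | ⟨u, hu, y, rfl⟩
    · rw [(Submodule.mem_bot ℂ).mp hu]
      have h : (fun p q r : Fin 5 => (0 : Fin 5 → Fin 5 → ℂ) p r * y q) = 0 := by
        funext p q r; simp
      rw [h]; exact Submodule.zero_mem _
    · apply Submodule.subset_span
      simp only [Set.mem_union, Set.mem_setOf_eq]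
      exact Or.inl (Or.inl ⟨u, hu, y, rfl⟩)
    · rw [(Submodule.mem_bot ℂ).mp hu]
      have h : (fun p q r : Fin 5 => (0 : Fin 5 → Fin 5 → ℂ) r q * y p) = 0 := by
        funext p q r; simp
      rw [h]; exact Submodule.zero_mem _
  · have h : (fun p q r : Fin 5 => (0 : Fin 5 → Fin 5 → Fin 5 → ℂ) p r q) = 0 := by
      funext p q r; simp
    rw [h]; exact Submodule.zero_mem _
  · intro S T _ _ hS hT
    have h : (fun p q r : Fin 5 => (S + T) p r q) = (fun p q r => S p r q) + (fun p q r => T p r q) := by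
      funext p q r; simp
    rw [h]; exact Submodule.add_mem _ hS hT
  · intro a S _ hS
    have h : (fun p q r : Fin 5 => (a • S) p r q) = a • (fun p q r => S p r q) := by
      funext p q r; simp
    rw [h]; exact Submodule.smul_mem _ a hS

/-- A piece of direction `12 | 0` becomes a piece of direction `01 | 2` after the cyclic shift of the slots. [folklore] -/
theorem cycle_mem_L3 (U12 : Submodule ℂ (Fin 5 → Fin 5 → ℂ)) (C : Fin 5 → Fin 5 → Fin 5 → ℂ)
    (hC : C ∈ L3 ⊥ ⊥ U12) : (fun p q r => C r p q) ∈ L3 U12 ⊥ ⊥ := by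
  unfold L3 at hC ⊢
  refine Submodule.span_induction ?_ ?_ ?_ ?_ hC
  · rintro T hT
    simp only [Set.mem_union, Set.mem_setOf_eq] at hT
    rcases hT with (⟨u, hu, y, rfl⟩ | ⟨u, hu, y, rfl⟩) | ⟨u, hu, y, rfl⟩
    · rw [(Submodule.mem_bot ℂ).mp hu]
      have h : (fun p q r : Fin 5 => (0 : Fin 5 → Fin 5 → ℂ) r p * y q) = 0 := by
        funext p q r; simp
      rw [h]; exact Submodule.zero_mem _
    · rw [(Submodule.mem_bot ℂ).mp hu]
      have h : (fun p q r : Fin 5 => (0 : Fin 5 → Fin 5 → ℂ) r q * y p) = 0 := by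
        funext p q r; simp
      rw [h]; exact Submodule.zero_mem _
    · apply Submodule.subset_span
      simp only [Set.mem_union, Set.mem_setOf_eq]
      exact Or.inl (Or.inl ⟨u, hu, y, rfl⟩)
  · have h : (fun p q r : Fin 5 => (0 : Fin 5 → Fin 5 → Fin 5 → ℂ) r p q) = 0 := by
      funext p q r; simp
    rw [h]; exact Submodule.zero_mem _
  · intro S T _ _ hS hT
    have h : (fun p q r : Fin 5 => (S + T) r p q) = (fun p q r => S r p q) + (fun p q r => T r p q) := by
      funext p q r; simp
    rw [h]; exact Submodule.add_mem _ hS hT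
  · intro a S _ hS
    have h : (fun p q r : Fin 5 => (a • S) r p q) = a • (fun p q r => S r p q) := by
      funext p q r; simp
    rw [h]; exact Submodule.smul_mem _ a hS

/-- The hub contraction of a `01 | 2` piece over `U` lies in `U` (✓ `L3_le_comap_hub`, restated as a membership). [folklore] -/
theorem hub_mem_of_L3 (U : Submodule ℂ (Fin 5 → Fin 5 → ℂ)) (A : Fin 5 → Fin 5 → Fin 5 → ℂ) (hA : A ∈ L3 U ⊥ ⊥) :
    hub A ∈ U :=
  Submodule.mem_comap.mp (L3_le_comap_hub U hA)

/-- **CAPTURE BY SYMMETRIC PIECES ⇒ `dim W ≤ dim(U₀₁ ⊔ U₀₂ ⊔ U₁₂)`.**  If every obligation `P₅ ⌞ μ` (`μ ∈ W`, symmetric zero-diagonal)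
splits as `A + B + C` with `A ∈ U₀₁ ⊗ V₂`, `B ∈ U₀₂ ⊗ V₁` symmetric in the slots `1,2`, and `C ∈ U₁₂ ⊗ V₀` invariant under the cyclic shift of
the slots, then the hub contraction embeds `W` into `U₀₁ + U₀₂ + U₁₂`.  The `Ω = 0` sector of `CaptureIneqSym` (all pieces fully symmetric). [folklore] -/
theorem capture_of_symmetric_pieces (U01 U02 U12 W : Submodule ℂ (Fin 5 → Fin 5 → ℂ))
    (hWs : ∀ μ ∈ W, ∀ s t : Fin 5, μ s t = μ t s) (hWd : ∀ μ ∈ W, ∀ s : Fin 5, μ s s = 0)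
    (hWc : ∀ μ ∈ W, ∃ A B C : Fin 5 → Fin 5 → Fin 5 → ℂ,
      A ∈ L3 U01 ⊥ ⊥ ∧ B ∈ L3 ⊥ U02 ⊥ ∧ C ∈ L3 ⊥ ⊥ U12 ∧
      (∀ p q r, B p q r = B p r q) ∧ (∀ p q r, C p q r = C r p q) ∧ contractZ μ = A + B + C) :
    Module.finrank ℂ W ≤ Module.finrank ℂ (U01 ⊔ U02 ⊔ U12 : Submodule ℂ (Fin 5 → Fin 5 → ℂ)) := by
  have hGmem : ∀ μ ∈ W, (hub ∘ₗ cZ) μ ∈ (U01 ⊔ U02 ⊔ U12 : Submodule ℂ (Fin 5 → Fin 5 → ℂ)) := by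
    intro μ hμ
    obtain ⟨A, B, C, hA, hB, hC, hBs, hCs, hsum⟩ := hWc μ hμ
    have hBeq : hub B = hub (fun p q r => B p r q) := by
      funext p q
      simp only [hub_apply]
      exact Finset.sum_congr rfl fun r _ => hBs p q r
    have hCeq : hub C = hub (fun p q r => C r p q) := by
      funext p q
      simp only [hub_apply]
      exact Finset.sum_congr rfl fun r _ => hCs p q r
    have h1 : hub A ∈ U01 := hub_mem_of_L3 U01 A hA
    have h2 : hub B ∈ U02 := by rw [hBeq]; exact hub_mem_of_L3 U02 _ (swap_mem_L3 U02 B hB)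
    have h3 : hub C ∈ U12 := by rw [hCeq]; exact hub_mem_of_L3 U12 _ (cycle_mem_L3 U12 C hC)
    have h : (hub ∘ₗ cZ) μ = hub A + hub B + hub C := by
      rw [LinearMap.comp_apply, cZ_apply, hsum, map_add, map_add]
    rw [h]
    exact Submodule.add_mem _ (Submodule.add_mem _ (Submodule.mem_sup_left (Submodule.mem_sup_left h1))
      (Submodule.mem_sup_left (Submodule.mem_sup_right h2))) (Submodule.mem_sup_right h3)
  let f : W →ₗ[ℂ] (U01 ⊔ U02 ⊔ U12 : Submodule ℂ (Fin 5 → Fin 5 → ℂ)) :=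
    LinearMap.codRestrict (U01 ⊔ U02 ⊔ U12) ((hub ∘ₗ cZ).domRestrict W) (fun x => hGmem x.1 x.2)
  apply LinearMap.finrank_le_finrank_of_injective (f := f)
  rw [injective_iff_map_eq_zero]
  intro x hx
  have h0 : (hub ∘ₗ cZ) x.1 = 0 := by
    have := congrArg Subtype.val hx
    simpa [f] using this
  have hμ : (x.1 : Fin 5 → Fin 5 → ℂ) = 0 :=
    hub_injective x.1 (hWs x.1 x.2) (hWd x.1 x.2) (fun p q => by
      have := congrFun (congrFun h0 p) q
      simpa [hub_apply, cZ_apply] using this)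
  exact Subtype.ext hμ

/-- **CAPTURE BY SYMMETRIC PIECES ⇒ the capture inequality** `dim W ≤ dim U₀₁ + dim U₀₂ + dim U₁₂`. [folklore] -/
theorem capture_of_symmetric_pieces' (U01 U02 U12 W : Submodule ℂ (Fin 5 → Fin 5 → ℂ))
    (hWs : ∀ μ ∈ W, ∀ s t : Fin 5, μ s t = μ t s) (hWd : ∀ μ ∈ W, ∀ s : Fin 5, μ s s = 0)
    (hWc : ∀ μ ∈ W, ∃ A B C : Fin 5 → Fin 5 → Fin 5 → ℂ,
      A ∈ L3 U01 ⊥ ⊥ ∧ B ∈ L3 ⊥ U02 ⊥ ∧ C ∈ L3 ⊥ ⊥ U12 ∧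
      (∀ p q r, B p q r = B p r q) ∧ (∀ p q r, C p q r = C r p q) ∧ contractZ μ = A + B + C) :
    Module.finrank ℂ W ≤ Module.finrank ℂ U01 + Module.finrank ℂ U02 + Module.finrank ℂ U12 := by
  refine (capture_of_symmetric_pieces U01 U02 U12 W hWs hWd hWc).trans ?_
  exact (Submodule.finrank_add_le_finrank_add_finrank _ _).trans
    (Nat.add_le_add_right (Submodule.finrank_add_le_finrank_add_finrank _ _) _)

end LaplaceFiveSeparatedCapture

end Summit.ValiantsHypothesis.ValiantsHypothesis.Theorems.RigidityForcesSymmetryRankRigidMinimalRepr
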